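import Summits.HubbardSuperconductivity.HubbardSuperconductivity.Theorems.AnisotropyChordTransferFibre3N1RowCellSound
import Summits.HubbardSuperconductivity.HubbardSuperconductivity.Theorems.AnisotropyChordTransferFibre3FinNamedCell
import Summits.HubbardSuperconductivity.HubbardSuperconductivity.Theorems.AnisotropyChordTransferFibre3FinN1CheckBox

/-!
# Route `AnisotropyChord` / H0 rotor rung: ★★★ the row-`N₁` RExpr program on a PER-`L` cell bounds the trial gap (FIN, `16 ≤ L`)

The per-`L` counterpart of p2's `…N1RowCellSound.trialGap_of_cellCheck` (which serves every `L ≥ 128` at once from an L-free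
box): for ONE lattice size `L ≥ 16` the sixteen-variable base box is `FinCell.finBoxG L la lb` of `…FinNamedCell` — `θ²` tight,
the twelve named sums EXACT at this `L` on the λ-cell `[la, lb]/D`, and the `a = Δf(x̂)`-interval COMPUTED from the cell (ground
manifold), so per-`L` cells are one-dimensional.  On that box the same corrected RExpr program runs:
* `cellFinalBoxCB`, ★ `n1CellCheckCB B M₂ cmin (prec, iters)` — p2's corrected checker `n1CellCheckC` with `c.box a₁ a₂ ↦ B`
  (`n1CellCheckC_eq_checkCB : n1CellCheckC c a₁ a₂ … = n1CellCheckCB (c.box a₁ a₂) …`), ★ `n1CellCheckCB_sound` (verbatim);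
* ★ `finCellCheck L la lb cmin (prec, iters) : Bool` — `groundCellCheck` ∧ `a`-interval inside `[0, 1)` ∧ `lb·L² < 16·D` (`ν < 4/π²`)
  ∧ `n1CellCheckCB (finBoxG L la lb) 2 cmin …`;
* ★★★ `trialGap_of_finCellCheck (hL : 16 ≤ L) (h : finCellCheck L la lb cmin pi = true) … (hf : IsGroundTwoMagnon L Δ λ₂ f)
  (hla : la ≤ λ₂·D) (hlb : λ₂·D ≤ lb) : cmin · Uunit ≤ trialGapN1` — p2's composition with `fin_pmem_xTrue_ground` for the box
  bridge and the cell's own regime checks in place of `ManifoldA.manifold_band` / `nu_ceiling` (the only `L ≥ 128` inputs).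
This is the composition the lead's ruling R1 (STATUS 2026-08-30 07:51Z: FIN per-`L` for `16 ≤ L ≤ 47` by `FinNamedCell` + the same
RExpr program) needs; the per-`L` kernel facts `finCellCheck L la lb c pi = true` and their λ-covers are separate files.
Prover seat `hubbard-h0-rotor-p3` g5; helper for piece A = stmt-HubbardSuperconductivity-23918 of rung 19089 (`--supports`, helper
class).  WHAT THIS IS NOT: nothing here proves superconductivity in the Hubbard model (rotor TARGET as worded stays FALSE, g15
verdict); it reduces ONE hypothesis (`TrialGapAbs`, row `N₁`) of ONE conditional reduction at one `L` to kernel cell checks.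
Tree imports only; no sorry, no new axioms.
-/

set_option linter.dupNamespace false
set_option autoImplicit false

open Literature.Analysis.ValidatedNumerics

namespace Summit.HubbardSuperconductivity.HubbardSuperconductivity.Theorems.AnisotropyChord.Transfer.Fibre3.L2.N1

/-! ## The corrected checker on a base box -/

/-- the final box over a base box `B` (stages 1–2, corrected objects), if all enclosures succeed. -/
def cellFinalBoxCB (B : Box) (M2 : ℕ) (pi : ℕ × ℕ) : Option Box :=
  match cellBoxB B M2 pi with
  | none => none
  | some B' =>
    match encloseObjs pi.1 pi.2 B' (objSpecsC M2) with
    | none => none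
    | some objs => some (finalBox B' objs)

/-- ★ THE CORRECTED ROW-`N₁` CELL CHECK on a base box `B`: `P̂ ≥ 1`, `U′ ≥ 1` and `cmin·U′ ≤ N₁′`. -/
def n1CellCheckCB (B : Box) (M2 : ℕ) (cmin : ℚ) (pi : ℕ × ℕ) : Bool :=
  match cellFinalBoxCB B M2 pi with
  | none => false
  | some F => rexprLeOn (.neg fP) (-1) F pi && rexprLeOn (.neg UpE) (-1) F pi && rexprLeOn (marginE cmin) 0 F pi

/-- p2's corrected checker is the base-box checker on `c.box a₁ a₂`. [folklore] -/
theorem n1CellCheckC_eq_checkCB (c : L2.NamedCell) (a1 a2 : ℚ) (M2 : ℕ) (cmin : ℚ) (pi : ℕ × ℕ) :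
    n1CellCheckC c a1 a2 M2 cmin pi = n1CellCheckCB (c.box a1 a2) M2 cmin pi := by
  unfold n1CellCheckC n1CellCheckCB cellFinalBoxC cellFinalBoxCB cellBox cellBoxB
  rfl

/-- ★ **SOUNDNESS OF `n1CellCheckCB` (interval layer)** — `n1CellCheckC_sound` for an arbitrary base box of length `16`. [folklore] -/
theorem n1CellCheckCB_sound (B : Box) (hB16 : B.length = 16) (M2 : ℕ) (cmin : ℚ) (pi : ℕ × ℕ)
    (h : n1CellCheckCB B M2 cmin pi = true) (hv : specsVarsOkC M2 = true) (X : ℕ → ℝ) (hX : PMem B X)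
    (hsp : ∀ j (hj : j < (specs M2).length), ((specs M2)[j].1).eval X ≤ X (16 + j) ∧ X (16 + j) ≤ ((specs M2)[j].2).eval X)
    (vs : List ℝ) (hvl : vs.length = 5)
    (hob : ∀ j (hj : j < (objSpecsC M2).length) (hj' : j < vs.length),
      ((objSpecsC M2)[j].1).eval X ≤ vs[j] ∧ vs[j] ≤ ((objSpecsC M2)[j].2).eval X) :
    1 ≤ finalVec X vs 6 ∧ 1 ≤ UpE.eval (finalVec X vs) ∧
      (cmin : ℝ) * UpE.eval (finalVec X vs) ≤ N1pE.eval (finalVec X vs) := by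
  simp only [specsVarsOkC, Bool.and_eq_true] at hv
  obtain ⟨hv1, hv2⟩ := hv
  have hS : SpecsHold X B.length (specs M2) := by
    rw [hB16]; exact specsHold_of X (specs M2) 16 hv1 hsp
  unfold n1CellCheckCB cellFinalBoxCB cellBoxB at h
  split at h
  · exact absurd h (by simp)
  · rename_i F hF
    split at hF
    · exact absurd hF (by simp)
    · rename_i B' hB'
      split at hF
      · exact absurd hF (by simp)
      · rename_i objs hobjs
        simp only [Option.some.injEq] at hF
        subst hF
        obtain ⟨hPB, hlenB⟩ := extendBox_sound pi.1 pi.2 X (specs M2) _ B' hB' hX hS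
        have hO : ObjsHold X B'.length (objSpecsC M2) vs := by
          rw [hlenB, hB16]
          exact objsHold_of X _ (objSpecsC M2) vs (by rw [hvl]; simp [objSpecsC]) hv2 hob
        have hbr := encloseObjs_sound pi.1 pi.2 hPB (objSpecsC M2) vs objs hobjs hO
        have hmem := finalBox_mem hPB (by
          rw [hlenB, hB16]
          simp only [specs, List.length_append, List.length_cons, List.length_nil, List.length_map]
          omega) hbr
        simp only [Bool.and_eq_true] at h
        obtain ⟨⟨hP, hU⟩, hM⟩ := h
        have eP := rexprLeOn_sound hP _ hmem
        have eU := rexprLeOn_sound hU _ hmem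
        have eM := rexprLeOn_sound hM _ hmem
        simp only [RExpr.eval] at eP eU eM
        refine ⟨?_, ?_, ?_⟩
        · have : (((-1 : ℚ)) : ℝ) = -1 := by push_cast; ring
          simp only [fP, RExpr.eval] at eP
          rw [this] at eP
          linarith
        · have : (((-1 : ℚ)) : ℝ) = -1 := by push_cast; ring
          rw [this] at eU
          linarith
        · simp only [marginE, RExpr.eval, cst] at eM
          have : (((0 : ℚ)) : ℝ) = 0 := by push_cast; ring
          rw [this] at eM
          linarith

/-! ## The per-`L` cell check -/

/-- ★ THE PER-`L` ROW-`N₁` CELL CHECK on the λ-cell `[la, lb]/D` at lattice size `L`: the ground-cell regime checks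
(`groundCellCheck`; the computed `a`-interval inside `[0, 1)`; `lb·L² < 16·D`, i.e. `ν < 4/π²`) and the corrected RExpr program
(`M₂ = 2`) on the per-`L` base box `finBoxG L la lb`. -/
def finCellCheck (L : ℕ) (la lb : ℤ) (cmin : ℚ) (pi : ℕ × ℕ) : Bool :=
  FinCell.groundCellCheck L la lb && decide (0 ≤ (FinCell.dfnnIv L la lb).1) && decide ((FinCell.dfnnIv L la lb).2 < Hole2.D)
    && decide (lb * (L : ℤ) ^ 2 < 16 * Hole2.D) && n1CellCheckCB (FinCell.finBoxG L la lb) 2 cmin pi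

variable (L : ℕ) [NeZero L]

/-- ★★★ **A PASSING PER-`L` CELL CHECK GIVES THE TRIAL-GAP BOUND ON THE CELL** (`16 ≤ L`, ground profile, `0 ≤ Δ < 1`,
`λ₂·D ∈ [la, lb]`): `cmin · U ≤ N₁`.  p2's `trialGap_of_cellCheck` with the per-`L` box bridge `FinCell.fin_pmem_xTrue_ground`
and the cell's regime checks. [folklore] -/
theorem trialGap_of_finCellCheck (hL : 16 ≤ L) {la lb : ℤ} {cmin : ℚ} {pi : ℕ × ℕ}
    (h : finCellCheck L la lb cmin pi = true)
    {Δ lam2 : ℝ} {f : Tor L → ℝ} (hΔ0 : 0 ≤ Δ) (hΔ1 : Δ < 1) (hf : IsGroundTwoMagnon L Δ lam2 f)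
    (hla : (la : ℝ) ≤ lam2 * ((Hole2.D : ℤ) : ℝ)) (hlb : lam2 * ((Hole2.D : ℤ) : ℝ) ≤ (lb : ℝ)) :
    (cmin : ℝ) * Uunit L Δ f ≤ trialGapN1 L Δ f := by
  classical
  unfold finCellCheck at h
  simp only [Bool.and_eq_true, decide_eq_true_eq] at h
  obtain ⟨⟨⟨⟨hg, ha0c⟩, ha1c⟩, hνc⟩, hchk⟩ := h
  set X := xTrue L Δ lam2 f (Δ * f (K1 L)) with hXdef
  set θ : ℝ := 2 * Real.pi / L with hθ
  have hLpos : (0 : ℝ) < L := by exact_mod_cast (show 0 < L by omega)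
  have hπ := Real.pi_pos
  have hθpos : 0 < θ := by positivity
  have ht0 : 0 < θ ^ 2 := by positivity
  have hD := Hole2.D_pos
  -- regime facts
  have hlam : 0 < lam2 := lam2_pos L (by omega) hΔ1 hf.1
  have h2 : 2 * lam2 < eps1 L := two_lam2_lt_eps1 L (by omega) hΔ0 hf
  have ha0 : 0 ≤ Δ * f (K1 L) := mul_nonneg hΔ0 (le_of_lt hf.1.2.2.1)
  -- `a < 1` from the cell's computed `a`-interval
  have hm := FinCell.mem_deltaMulFnn_cell L (by omega) hlam hla hlb hg
  rw [← ground_delta_eq L (by omega) hΔ0 hΔ1 hf, ← ground_fnn_eq_explicit L (by omega) hΔ0 hΔ1 hf] at hm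
  have ha1 : Δ * f (K1 L) < 1 := by
    have h2' := hm.2
    have hc : (((FinCell.dfnnIv L la lb).2 : ℤ) : ℝ) < ((Hole2.D : ℤ) : ℝ) := by exact_mod_cast ha1c
    by_contra hcon
    rw [not_lt] at hcon
    nlinarith
  -- `ν < 4/π²` from `lb·L² < 16·D`
  have hν4 : lam2 / (2 * Real.pi / L) ^ 2 < 4 / Real.pi ^ 2 := by
    have hc : ((lb : ℤ) : ℝ) * (L : ℝ) ^ 2 < 16 * ((Hole2.D : ℤ) : ℝ) := by exact_mod_cast hνc
    have hlamL : lam2 * (L : ℝ) ^ 2 < 16 := by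
      by_contra hcon
      rw [not_lt] at hcon
      have : 16 * ((Hole2.D : ℤ) : ℝ) ≤ lam2 * ((Hole2.D : ℤ) : ℝ) * (L : ℝ) ^ 2 := by nlinarith
      nlinarith [mul_le_mul_of_nonneg_right hlb (sq_nonneg (L : ℝ))]
    rw [div_lt_div_iff₀ ht0 (by positivity), hθ, div_pow, mul_pow]
    field_simp
    nlinarith
  have hV1 : (1 : ℝ) / (L : ℝ) ^ 2 = θ ^ 2 * (4 * Real.pi ^ 2)⁻¹ := by
    rw [hθ]; field_simp; ring
  have hu' : 0 < 1 - Δ * f (K1 L) + Δ * f (K1 L) * ((2 * Real.pi / L) ^ 2 * (4 * Real.pi ^ 2)⁻¹) := by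
    have : 0 ≤ Δ * f (K1 L) * ((2 * Real.pi / L) ^ 2 * (4 * Real.pi ^ 2)⁻¹) := by positivity
    linarith
  obtain ⟨_, _, d3, _, d5, _, d7⟩ := ManifoldA.manifold_dictionary L (by omega) hΔ0 hΔ1 hf
  have hu : 0 < cS L Δ lam2 f * Gzero L lam2 := by
    rw [← Gres_zero_zero_eq_Gzero, d5]
    have : 1 - Δ * f (K1 L) + Δ * f (K1 L) / (L : ℝ) ^ 2
        = 1 - Δ * f (K1 L) + Δ * f (K1 L) * ((2 * Real.pi / L) ^ 2 * (4 * Real.pi ^ 2)⁻¹) := by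
      rw [← hθ, ← hV1]; ring
    rw [this]; exact hu'
  -- the interval layer
  have hPM : PMem (FinCell.finBoxG L la lb) X := FinCell.fin_pmem_xTrue_ground L (by omega) hΔ0 hΔ1 hf hlam hla hlb hg
  have hsp := xTrue_specs_ground L Δ lam2 f (by omega) hΔ0 hΔ1 hf hlam h2 hν4 ha0 hu'
  set vB : ℝ := ((2 * Real.pi / L) ^ 2) ^ 3 * ∑ k : Tor L, F2 L f k ^ 2 * F2 L f (k + K1 L) with hvB
  set vP : ℝ := ((2 * Real.pi / L) ^ 2) ^ 3 * ∑ k : Tor L, F2 L f k ^ 3 with hvP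
  set vA : ℝ := ((2 * Real.pi / L) ^ 2) ^ 2 * ∑ k : Tor L, F2 L f k ^ 2 * cosx L k with hvA
  set vQ : ℝ := ((2 * Real.pi / L) ^ 2) ^ 2 * ∑ k : Tor L, nK L f k * F2 L f k with hvQ
  set vJ : ℝ := ((2 * Real.pi / L) ^ 2) ^ 2 * ∑ k : Tor L, bcJ L f k with hvJ
  have oB := bHat_mem L Δ lam2 f (by omega) hΔ0 hΔ1 hf hlam h2 hu
  have oP := pHat_mem L Δ lam2 f (by omega) hΔ0 hΔ1 hf hlam h2 hu
  have oA := aHat_mem L Δ lam2 f (by omega) hΔ0 hΔ1 hf hlam h2 hu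
  have oQ := q1Hat_mem L Δ lam2 f (by omega) hΔ0 hΔ1 hf hlam h2 hu
  have oJ := j1Hat_mem L Δ lam2 f (by omega) hΔ0 hΔ1 hf hlam h2 hu
  have hob : ∀ j (hj : j < (objSpecsC 2).length) (hj' : j < [vB, vP, vA, vQ, vJ].length),
      ((objSpecsC 2)[j].1).eval X ≤ [vB, vP, vA, vQ, vJ][j] ∧ [vB, vP, vA, vQ, vJ][j] ≤ ((objSpecsC 2)[j].2).eval X := by
    intro j hj hj'
    have hj5 : j < 5 := by simpa [objSpecsC] using hj
    interval_cases j
    · simpa [objSpecsC] using oB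
    · simpa [objSpecsC] using oP
    · simpa [objSpecsC] using oA
    · simpa [objSpecsC] using oQ
    · simpa [objSpecsC] using oJ
  obtain ⟨hP1, hU1, hM⟩ := n1CellCheckCB_sound _ (FinCell.finBoxG_length L la lb) 2 cmin pi hchk specsVarsOkC_two X hPM hsp
    [vB, vP, vA, vQ, vJ] rfl hob
  obtain ⟨y0, y1, y2, y3, y4, y5, y6, y7, y8, y9⟩ := finalVec_vals X vB vP vA vQ vJ
  set y := finalVec X [vB, vP, vA, vQ, vJ] with hy
  -- coordinates of `X`
  have hX0 : X 0 = θ ^ 2 := xTrue_zero L Δ lam2 f _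
  have hX1 : X 1 = Real.pi ^ 2 := by rw [hXdef, xTrue_lt16 L Δ lam2 f _ (by norm_num)]; rfl
  have hX2 : X 2 = lam2 / θ ^ 2 := by rw [hXdef, xTrue_lt16 L Δ lam2 f _ (by norm_num)]; rfl
  have hX3 : X 3 = Δ * f (K1 L) := by rw [hXdef, xTrue_lt16 L Δ lam2 f _ (by norm_num)]; rfl
  have hX16 : X 16 = eps1 L / θ ^ 2 := by rw [hXdef, xTrue_16]; rfl
  rw [y6] at hP1
  have hvP0 : 0 < vP := by linarith
  -- the assembly expressions at `y`
  have eN : N1pE.eval y = -(6 * y 4 * y 5) + 9 * y 8 * y 5 * (y 6)⁻¹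
      - 1 / 2 * y 4 * y 0 * (3 * y 2 * y 6 + -(3 / 2 * y 8) + 12 * (y 3 * (y 3 + y 1 * y 2)) * y 7) - 3 * y 9 := by
    simp only [N1pE, rsum, RExpr.eval, cst, fE1, fB, fQ, fP, fT, fNu, fA, fPi2, fAx, fJ]; push_cast; ring
  have eU : UpE.eval y = 192 * (y 1) ^ 3 * (3 * y 2 - 3 / 2 * y 8 * (y 6)⁻¹) := by
    simp only [UpE, cube, RExpr.eval, cst, fPi2, fNu, fQ, fP]; push_cast; ring
  -- the true `N₁` and `U`
  have heven : ∀ r : Tor L, f (-r) = f r := hf.2.1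
  have hswap : ∀ r : Tor L, f (r.2, r.1) = f r := ground_swap L (by omega) hf
  have hN1 := n1Identity_holds L Δ lam2 f hf.1
  have hG2 := g2OneLoopForm_holds L (by omega) Δ lam2 f hf.1 heven hswap
  have hQP := sum_piR_C0fn L hf.1
  have hPf := piNormOneLoop_holds L f heven
  have hBf := btermOneLoop_holds L f heven
  have hAf := axhatOneLoop_holds L f heven
  have hQf := piC0OneLoop_holds L Δ lam2 f hf.1 heven
  have hCf := bcOneLoop_holds L Δ lam2 f hf.1 heven
  rw [nn_sum_swap] at hQf hCf
  -- express everything through the hatted values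
  have hV : ((L : ℝ) ^ 2) = 4 * Real.pi ^ 2 / θ ^ 2 := by rw [hθ]; field_simp; ring
  have eP : PiNormSq L f = vP / (θ ^ 4 * (4 * Real.pi ^ 2)) := by
    rw [hPf, hvP, hV, ← hθ]; field_simp
  have eB : Bterm L f = 6 * vB / (θ ^ 4 * (4 * Real.pi ^ 2)) := by
    rw [hBf, hvB, hV, ← hθ]; field_simp
  have eA : Axhat L f = vA / (θ ^ 2 * (4 * Real.pi ^ 2)) := by
    rw [hAf, hvA, hV, ← hθ]; unfold cosx; field_simp
  have eQ : ∑ cc : Cfg L, piR L f cc * C0fn L Δ lam2 f cc = -(3 / 2) * vQ / (θ ^ 2 * (4 * Real.pi ^ 2)) := by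
    rw [hQf, hvQ, hV, ← hθ]; unfold nK
    simp only [List.sum_map_mul_right]
    field_simp
  have eC : BCterm L Δ lam2 f = -3 * vJ / (θ ^ 2 * (4 * Real.pi ^ 2)) := by
    rw [hCf, hvJ, hV, ← hθ]; unfold bcJ bcSummand; field_simp
  have hPpos : 0 < PiNormSq L f := by rw [eP]; positivity
  have hT : Tplus L Δ f = 3 * lam2 + (∑ cc : Cfg L, piR L f cc * C0fn L Δ lam2 f cc) / PiNormSq L f := by
    rw [hQP]; field_simp; ring
  have hNval : trialGapN1 L Δ f = N1pE.eval y / (4 * Real.pi ^ 2 * θ ^ 2) := by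
    rw [eN, y0, y1, y2, y3, y4, y5, y6, y7, y8, y9, hX0, hX1, hX2, hX3, hX16, ← d7, ← d3, hN1, hG2, hT, eQ, eP, eB, eA, eC]
    field_simp
    ring
  have hUval : Uunit L Δ f = UpE.eval y / (4 * Real.pi ^ 2 * θ ^ 2) := by
    unfold Uunit
    rw [eU, y1, y2, y6, y8, hX1, hX2, hT, eQ, eP, hV]
    field_simp
    ring
  rw [hNval, hUval, mul_div_assoc']
  exact div_le_div_of_nonneg_right hM (by positivity)

end Summit.HubbardSuperconductivity.HubbardSuperconductivity.Theorems.AnisotropyChord.Transfer.Fibre3.L2.N1
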